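import Mathlib
import Summits.KontsevichZagierPeriods.KontsevichZagierPeriods.Theses.GenusOneIterated
import Summits.KontsevichZagierPeriods.KontsevichZagierPeriods.Theorems.HermiteRigidityGenusTwoCycleTransferPushforwardDimOne
import Literature.NumberTheory.Transcendental.KZSemiCanonicalReductionProofs
import Summits.KontsevichZagierPeriods.KontsevichZagierPeriods.Theorems.GenusOneIteratedKummerFamilyCells

/-!
# `KummerFamily` (item stmt-KontsevichZagierPeriods-6780, route GenusOneIterated): the length-two
genus-one iterated integral between 2-torsion points is a Kummer logarithm, by KZ moves

**Claim (route decl `…Theses.GenusOneIterated.KummerFamily`).** For real algebraic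
`e₃ < e₂ < e₁`, `f = 4(x − e₁)(x − e₂)(x − e₃)`, any KZ representation `r` on the open triangle
`T = {e₃ < x₀ < x₁ < e₂}` with integrand `(x₁ − x₀)/(√f(x₀)√f(x₁))` (= `I(ωη) − I(ηω)` along the
upper arc of the real oval) is KZ-equivalent to any representation `r'` on `(e₁ − e₂, e₁ − e₃)`
with integrand `1/(2u)` (= `½ log((e₁ − e₃)/(e₁ − e₂))`).

**Certificate (nine moves, no regularisation, no torsion argument).** With
`σ(x) = e₁ + A/(x − e₁)` (`A = (e₁−e₂)(e₁−e₃)`; the abscissa of `P₁ − P`) and the involution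
`Φ(x₀,x₁) = (σx₁, σx₀)` of `T`, whose fixed curve `x₁ = σ(x₀)` cuts `T` into `T₁ ∪ T₂`:
(R1) `[r] = [r|T₁] + [r|T₂]` (rule 1a); (R2) `[r|T₂] = [s]`, `s = Φ^*(r|T₂)` on `T₁` with
integrand `(σx₀ − σx₁)/(√f(x₀)√f(x₁))` since `σ^*(dx/√f) = −dx/√f` (rule 2);
(R3) `[r|T₁] + [s] = [t]` (rule 1b); (R4) `[t] = [a] + [b]` with
`a = (σx₀ − x₀)/(√f√f)`, `b = B := −(σx₁ − x₁)/(√f(x₁)√f(x₀))` (rule 1b — the planner's identity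
`(σ(x) − x)/y = d/dx[√f/(2(e₁ − x))] = φ′(x)`); (R5) `[a] = [B|T₂]` by the same reflection
(rule 2); (R6) `[B|T₁] + [B|T₂] = [B|T]` (rule 1a); (R7) `[B|T] = [B|band]` on the closed band
`{e₃ < x₀ < e₂, x₀ ≤ x₁ ≤ e₂}` (null modification); (R8) Newton–Leibniz in `x₁` with the
ALGEBRAIC primitive `F = −φ(x₁)/√f(x₀)`, `φ(e₂) = 0`, giving the base integrand
`φ(x₀)/√f(x₀) = 1/(2(e₁ − x₀))` on `(e₃, e₂)` (rule 3); (R9) the affine change of variables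
`u = e₁ − x₀` onto `r'` (rule 2). The value of the symmetric term
`∫_{T} φ′(x₀)/√f(x₁)` is never evaluated: (R5) trades it for the `B`-integral over `T₂`, which
avoids the factor `2[r]` of the naive symmetrisation (and hence any appeal to torsion-freeness of
`P_KZ`). Barrier `noSemialgebraicPrimitive_inv_sub_two` is not engaged: the only primitive used is
the algebraic `φ`, and the logarithm stays unfolded as `∫ du/(2u)`.

`KummerFamily_proof` concludes the route declaration by name.

References: Kontsevich–Zagier, *Periods* (2001), §1.2; Whittaker–Watson (1927), §20.33;
Lawden (1989), §6.12; Silverman, *The Arithmetic of Elliptic Curves* (2009), III.2.3.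
-/

noncomputable section

open Set MeasureTheory
open Literature.NumberTheory.Transcendental Literature.ModelTheory.ExponentialFields

namespace Summit.KontsevichZagierPeriods.GenusOneIterated.KummerFamily

variable (E : KZ.EllCurve)

/-! ### (R8) Newton–Leibniz along `x₁` with the algebraic primitive `−φ(x₁)/√f(x₀)` -/

/-- **Move (R8).** For the representation of `B = −(σx₁ − x₁)/(√f(x₁)√f(x₀))` on the closed band
`{e₃ < x₀ < e₂, x₀ ≤ x₁ ≤ e₂}`, Newton–Leibniz along `x₁` (KZ rule 3) with the `ℚ`-semialgebraic
primitive `F(x₀, x₁) = −φ(x₁)/√f(x₀)`, `φ = √f/(2(e₁ − x))` (continuous on the closed fibre,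
`∂F/∂x₁ = B` on the open fibre, `φ(e₂) = 0`) produces a base representation on `(e₃, e₂)` whose
integrand is `φ(x₀)/√f(x₀) = 1/(2(e₁ − x₀))`. [cite: KontsevichZagier2001, §1.2 rule (3)] -/
theorem nl_move (bB : KZ.IntegralRep 2)
    (hdom : bB.domain = {z : Fin 2 → ℝ | Fin.init z ∈ {p : Fin 1 → ℝ | E.e₃ < p 0 ∧ p 0 < E.e₂} ∧
        Fin.init z 0 ≤ z (Fin.last 1) ∧ z (Fin.last 1) ≤ E.e₂})
    (hint : bB.integrand = fun x : Fin 2 → ℝ =>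
      -((E.e₁ + (E.e₁ - E.e₂) * (E.e₁ - E.e₃) / (x 1 - E.e₁) - x 1) / √(E.f (x 1))) *
        (1 / √(E.f (x 0)))) :
    ∃ q : KZ.IntegralRep 1, q.domain = {p : Fin 1 → ℝ | E.e₃ < p 0 ∧ p 0 < E.e₂} ∧
      EqOn q.integrand (fun p => 1 / (2 * (E.e₁ - p 0))) q.domain ∧
      KZ.of bB - KZ.of q ∈ KZ.relations := by
  have h21 := E.e₂_lt_e₁
  have snoc_apply_zero : ∀ (p : Fin 1 → ℝ) (t : ℝ), (Fin.snoc p t : Fin 2 → ℝ) 0 = p 0 :=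
    fun _ _ => rfl
  have snoc_apply_one : ∀ (p : Fin 1 → ℝ) (t : ℝ), (Fin.snoc p t : Fin 2 → ℝ) 1 = t :=
    fun _ _ => rfl
  -- the base `τ = (e₃, e₂)`
  have hτ : IsSemialgebraic ℚ {p : Fin 1 → ℝ | E.e₃ < p 0 ∧ p 0 < E.e₂} :=
    (KZ.isSemialgebraic_setOf_const_lt_apply E.isAlgebraic_e₃ 0).inter
      (KZ.isSemialgebraic_setOf_apply_lt_const E.isAlgebraic_e₂ 0)
  -- the primitive and the base integrand
  set F : (Fin 2 → ℝ) → ℝ := fun z =>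
    -(√(E.f (z 1)) / (2 * (E.e₁ - z 1))) * (1 / √(E.f (z 0))) with hF_def
  have hQ : ∀ p ∈ {p : Fin 1 → ℝ | E.e₃ < p 0 ∧ p 0 < E.e₂},
      F (Fin.snoc p E.e₂) - F (Fin.snoc p (p 0)) = 1 / (2 * (E.e₁ - p 0)) := by
    intro p hp
    simp only [hF_def, snoc_apply_zero, snoc_apply_one]
    rw [phi_e₂ E, neg_mul, neg_mul, phi_mul_inv_sqrt E hp.1 hp.2]
    ring
  -- the rational base integrand is semialgebraic and integrable on `τ`
  have hrat_sa : IsSemialgebraicFunOn ℚ {p : Fin 1 → ℝ | E.e₃ < p 0 ∧ p 0 < E.e₂}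
      (fun p => 1 / (2 * (E.e₁ - p 0))) := by
    have h2 : IsSemialgebraicFunOn ℚ {p : Fin 1 → ℝ | E.e₃ < p 0 ∧ p 0 < E.e₂}
        (fun _ => (2 : ℝ)) := by
      simpa using isSemialgebraicFunOn_natCast (k := ℚ) (R := ℝ) hτ 2
    exact isSemialgebraicFunOn_one_div (IsSemialgebraicFunOn.mul_holds h2
      (IsSemialgebraicFunOn.sub_holds (isSemialgebraicFunOn_const_of_isAlgebraic hτ
        E.isAlgebraic_e₁) (isSemialgebraicFunOn_coord hτ 0)))
  have hrat_int : IntegrableOn (fun p : Fin 1 → ℝ => 1 / (2 * (E.e₁ - p 0)))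
      {p : Fin 1 → ℝ | E.e₃ < p 0 ∧ p 0 < E.e₂} := by
    have hK : IsCompact (Set.pi univ fun _ : Fin 1 => Icc E.e₃ E.e₂) :=
      isCompact_univ_pi fun _ => isCompact_Icc
    have hcont : ContinuousOn (fun p : Fin 1 → ℝ => 1 / (2 * (E.e₁ - p 0)))
        (Set.pi univ fun _ : Fin 1 => Icc E.e₃ E.e₂) := by
      refine ContinuousOn.div continuousOn_const (by fun_prop) fun p hp => ?_
      have h : p 0 ≤ E.e₂ := (hp 0 (mem_univ _)).2
      exact mul_ne_zero two_ne_zero (sub_ne_zero.2 (h.trans_lt h21).ne')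
    refine (hcont.integrableOn_compact hK).mono_set fun p hp i _ => ?_
    rw [Subsingleton.elim i 0]
    exact ⟨hp.1.le, hp.2.le⟩
  -- the base representation
  let q : KZ.IntegralRep 1 :=
    { domain := {p : Fin 1 → ℝ | E.e₃ < p 0 ∧ p 0 < E.e₂}
      integrand := fun p => F (Fin.snoc p E.e₂) - F (Fin.snoc p (p 0))
      isSemialgebraic_domain := hτ
      isSemialgebraicFunOn_integrand := hrat_sa.congr fun p hp => (hQ p hp).symm
      integrableOn := hrat_int.congr_fun (fun p hp => (hQ p hp).symm)
        (IsSemialgebraic.measurableSet_holds hτ) }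
  have hband1 : ∀ z ∈ bB.domain, z 1 ≠ E.e₁ := fun z hz => by
    rw [hdom, mem_band_iff] at hz
    exact (hz.2.2.2.trans_lt h21).ne
  refine ⟨q, rfl, fun p hp => hQ p hp, KZ.newtonLeibnizRel_subset_relations
    ⟨1, bB, q, fun p => p 0, fun _ => E.e₂, F, ?_, isSemialgebraicFunOn_coord hτ 0,
      isSemialgebraicFunOn_const_of_isAlgebraic hτ E.isAlgebraic_e₂, fun p hp => hp.2.le, hdom,
      fun p _ => ?_, fun p hp t ht => ?_, fun _ _ => rfl, rfl⟩⟩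
  · -- the primitive is semialgebraic on the band
    exact (IsSemialgebraicFunOn.mul_holds
      (isSemialgebraicFunOn_phi_apply E bB.isSemialgebraic_domain 1 hband1).neg
      (isSemialgebraicFunOn_inv_sqrt_f_apply E bB.isSemialgebraic_domain 0)).congr
      fun z _ => by simp only [hF_def, Pi.mul_apply, Pi.neg_apply]
  · -- continuity on the closed fibre `[p 0, e₂]`
    show ContinuousOn (fun t : ℝ => -(√(E.f ((Fin.snoc p t : Fin 2 → ℝ) 1)) /
      (2 * (E.e₁ - (Fin.snoc p t : Fin 2 → ℝ) 1))) *
        (1 / √(E.f ((Fin.snoc p t : Fin 2 → ℝ) 0)))) (Icc (p 0) E.e₂)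
    simp only [snoc_apply_zero, snoc_apply_one]
    exact ((continuousOn_phi E).mono Icc_subset_Iic_self).neg.mul continuousOn_const
  · -- the derivative on the open fibre
    rw [hint]
    show HasDerivAt (fun s : ℝ => -(√(E.f ((Fin.snoc p s : Fin 2 → ℝ) 1)) /
      (2 * (E.e₁ - (Fin.snoc p s : Fin 2 → ℝ) 1))) *
        (1 / √(E.f ((Fin.snoc p s : Fin 2 → ℝ) 0)))) _ t
    simp only [snoc_apply_zero, snoc_apply_one]
    exact ((hasDerivAt_phi E (hp.1.trans ht.1) ht.2).neg.mul_const _)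

/-! ### (R9) The affine change of variables `u = e₁ − x₀` -/

/-- **Move (R9).** `[(e₃, e₂), 1/(2(e₁ − x))] − [(e₁ − e₂, e₁ − e₃), 1/(2u)]` is one
change-of-variables move `u = e₁ − x` (Jacobian `−1`). [cite: KontsevichZagier2001, §1.2 rule (2)] -/
theorem cov_affine (q r' : KZ.IntegralRep 1)
    (hq : q.domain = {p : Fin 1 → ℝ | E.e₃ < p 0 ∧ p 0 < E.e₂})
    (hqi : EqOn q.integrand (fun p => 1 / (2 * (E.e₁ - p 0))) q.domain)
    (hr' : r'.domain = {x : Fin 1 → ℝ | E.e₁ - E.e₂ < x 0 ∧ x 0 < E.e₁ - E.e₃})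
    (hr'i : EqOn r'.integrand (fun x => 1 / (2 * x 0)) r'.domain) :
    KZ.of q - KZ.of r' ∈ KZ.relations := by
  have hqs := q.isSemialgebraic_domain
  refine KZ.changeOfVariablesRel_subset_relations ⟨1, q, r', fun p _ => E.e₁ - p 0,
    fun _ => (-1 : ℝ) • ContinuousLinearMap.id ℝ (Fin 1 → ℝ), ?_, fun p _ => ?_, ?_, ?_, ?_, rfl⟩
  · exact IsSemialgebraicMapOn.of_forall hqs fun _ =>
      (IsSemialgebraicFunOn.sub_holds (isSemialgebraicFunOn_const_of_isAlgebraic hqs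
        E.isAlgebraic_e₁) (isSemialgebraicFunOn_coord hqs 0)).congr fun _ _ => rfl
  · exact (Summit.KontsevichZagierPeriods.HermiteRigidity.GenusTwoCycleTransfer.hasFDerivAt_fin_one
      (fun y => E.e₁ - y) (-1) p ((hasDerivAt_id' (p 0)).const_sub E.e₁)).hasFDerivWithinAt
  · intro p _ p' _ h
    have h0 : E.e₁ - p 0 = E.e₁ - p' 0 := congr_fun h 0
    funext i
    rw [Subsingleton.elim i 0]
    linarith
  · rw [hr', hq]
    ext u
    simp only [mem_image, mem_setOf_eq]
    constructor
    · rintro ⟨h1, h2⟩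
      refine ⟨fun _ => E.e₁ - u 0, ⟨by linarith, by linarith⟩, ?_⟩
      funext i
      rw [Subsingleton.elim i 0]
      ring
    · rintro ⟨p, ⟨h1, h2⟩, rfl⟩
      show E.e₁ - E.e₂ < E.e₁ - p 0 ∧ E.e₁ - p 0 < E.e₁ - E.e₃
      exact ⟨by linarith, by linarith⟩
  · intro p hp
    have hp' : (fun _ : Fin 1 => E.e₁ - p 0) ∈ r'.domain := by
      rw [hr']
      rw [hq] at hp
      exact ⟨by linarith [hp.2], by linarith [hp.1]⟩
    rw [hqi hp, hr'i hp',
      Summit.KontsevichZagierPeriods.HermiteRigidity.GenusTwoCycleTransfer.det_smul_id_fin_one]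
    simp

/-! ### The certificate -/

/-- **The nine-move certificate** (see the file header): for a real cubic `E` with real algebraic
2-torsion abscissae `e₃ < e₂ < e₁`, every KZ representation of
`∫∫_{e₃<x₀<x₁<e₂} (x₁ − x₀)/(√f(x₀)√f(x₁))` is KZ-equivalent to every KZ representation of
`∫_{e₁−e₂}^{e₁−e₃} du/(2u)`. [cite: KontsevichZagier2001, §1.2] -/
theorem equivalent (r : KZ.IntegralRep 2) (r' : KZ.IntegralRep 1)
    (hdom : r.domain = {x | E.e₃ < x 0 ∧ x 0 < x 1 ∧ x 1 < E.e₂})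
    (hint : EqOn r.integrand (fun x => (x 1 - x 0) / (√(E.f (x 0)) * √(E.f (x 1)))) r.domain)
    (hdom' : r'.domain = {x | E.e₁ - E.e₂ < x 0 ∧ x 0 < E.e₁ - E.e₃})
    (hint' : EqOn r'.integrand (fun x => 1 / (2 * x 0)) r'.domain) :
    KZ.Equivalent r r' := by
  have h21 := E.e₂_lt_e₁
  have hT : ∀ x, x ∈ r.domain ↔ E.e₃ < x 0 ∧ x 0 < x 1 ∧ x 1 < E.e₂ := fun x => by rw [hdom]; rfl
  have hTs : IsSemialgebraic ℚ r.domain := r.isSemialgebraic_domain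
  have hTb : ∀ x ∈ r.domain, E.e₃ < x 0 ∧ x 0 < E.e₂ ∧ E.e₃ < x 1 ∧ x 1 < E.e₂ := fun x hx => by
    obtain ⟨h0, h01, h1⟩ := (hT x).1 hx
    exact ⟨h0, h01.trans h1, h0.trans h01, h1⟩
  have hT0 : ∀ x ∈ r.domain, x 0 ≠ E.e₁ := fun x hx => ((hTb x hx).2.1.trans h21).ne
  have hT01 : ∀ x ∈ r.domain, x 0 ≠ E.e₁ ∧ x 1 ≠ E.e₁ := fun x hx =>
    ⟨hT0 x hx, ((hTb x hx).2.2.2.trans h21).ne⟩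
  -- the two half-triangles
  set T₁ : Set (Fin 2 → ℝ) :=
    {x | x ∈ r.domain ∧ x 1 ≤ E.e₁ + (E.e₁ - E.e₂) * (E.e₁ - E.e₃) / (x 0 - E.e₁)} with hT₁
  set T₂ : Set (Fin 2 → ℝ) :=
    {x | x ∈ r.domain ∧ E.e₁ + (E.e₁ - E.e₂) * (E.e₁ - E.e₃) / (x 0 - E.e₁) ≤ x 1} with hT₂
  have hT₁s : IsSemialgebraic ℚ T₁ := isSemialgebraic_T₁ E hTs hT0
  have hT₂s : IsSemialgebraic ℚ T₂ := isSemialgebraic_T₂ E hTs hT0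
  have hT₁T : T₁ ⊆ r.domain := fun x hx => hx.1
  have hT₂T : T₂ ⊆ r.domain := fun x hx => hx.1
  have hunion : r.domain = T₁ ∪ T₂ := by
    ext x
    simp only [hT₁, hT₂, mem_union, mem_setOf_eq]
    constructor
    · intro hx
      rcases le_total (x 1) (E.e₁ + (E.e₁ - E.e₂) * (E.e₁ - E.e₃) / (x 0 - E.e₁)) with h | h
      · exact Or.inl ⟨hx, h⟩
      · exact Or.inr ⟨hx, h⟩
    · rintro (⟨hx, -⟩ | ⟨hx, -⟩) <;> exact hx
  have hnull : volume (T₁ ∩ T₂) = 0 :=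
    volume_T₁_inter_T₂ E fun x hx => (hTb x hx).2.1.trans h21
  have hT₁' : T₁ = {x | (E.e₃ < x 0 ∧ x 0 < x 1 ∧ x 1 < E.e₂) ∧
      x 1 ≤ E.e₁ + (E.e₁ - E.e₂) * (E.e₁ - E.e₃) / (x 0 - E.e₁)} := by
    ext x; simp only [hT₁, mem_setOf_eq, hT]
  have hT₂' : T₂ = {x | (E.e₃ < x 0 ∧ x 0 < x 1 ∧ x 1 < E.e₂) ∧
      E.e₁ + (E.e₁ - E.e₂) * (E.e₁ - E.e₃) / (x 0 - E.e₁) ≤ x 1} := by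
    ext x; simp only [hT₂, mem_setOf_eq, hT]
  -- the reflection move
  set Φ : (Fin 2 → ℝ) → (Fin 2 → ℝ) := fun x =>
    (![E.e₁ + (E.e₁ - E.e₂) * (E.e₁ - E.e₃) / (x 1 - E.e₁),
        E.e₁ + (E.e₁ - E.e₂) * (E.e₁ - E.e₃) / (x 0 - E.e₁)] : Fin 2 → ℝ) with hΦ
  set Φ' : (Fin 2 → ℝ) → (Fin 2 → ℝ) →L[ℝ] (Fin 2 → ℝ) := fun x =>
    ContinuousLinearMap.pi
      ![(-((E.e₁ - E.e₂) * (E.e₁ - E.e₃)) / (x 1 - E.e₁) ^ 2) •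
          ContinuousLinearMap.proj (R := ℝ) (φ := fun _ : Fin 2 => ℝ) 1,
        (-((E.e₁ - E.e₂) * (E.e₁ - E.e₃)) / (x 0 - E.e₁) ^ 2) •
          ContinuousLinearMap.proj (R := ℝ) (φ := fun _ : Fin 2 => ℝ) 0] with hΦ'
  have hΦsa : IsSemialgebraicMapOn ℚ T₁ Φ := isSemialgebraicMapOn_Phi E hT₁s fun x hx => hT01 x hx.1
  have hΦd : ∀ x ∈ T₁, HasFDerivWithinAt Φ (Φ' x) T₁ x := fun x hx =>
    (hasFDerivAt_Phi E (hT01 x hx.1).1 (hT01 x hx.1).2).hasFDerivWithinAt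
  have hΦinj : InjOn Φ T₁ := injOn_Phi E fun x hx => hT01 x hx.1
  have himage : Φ '' T₁ = T₂ := by rw [hT₁', hT₂']; exact image_Phi E
  have hmaps : MapsTo Φ T₁ T₂ := fun x hx => himage ▸ mem_image_of_mem Φ hx
  have hdet : ∀ x, (Φ' x).det = -((-((E.e₁ - E.e₂) * (E.e₁ - E.e₃)) / (x 1 - E.e₁) ^ 2) *
      (-((E.e₁ - E.e₂) * (E.e₁ - E.e₃)) / (x 0 - E.e₁) ^ 2)) := fun x => det_swapJacobian _ _
  have hT₁m : MeasurableSet T₁ := IsSemialgebraic.measurableSet_holds hT₁s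
  have hdetsa : IsSemialgebraicFunOn ℚ T₁ (fun x => |(Φ' x).det|) :=
    (IsSemialgebraicFunOn.mul_holds
      (isSemialgebraicFunOn_dsigma_apply E hT₁s 1 fun x hx => (hT01 x hx.1).2)
      (isSemialgebraicFunOn_dsigma_apply E hT₁s 0 fun x hx => (hT01 x hx.1).1)).neg.abs.congr
      fun x _ => by simp only [Pi.neg_apply, Pi.mul_apply, hdet]
  -- pulling back an integrable semialgebraic function along `Φ : T₁ → T₂`
  have hpull : ∀ g : (Fin 2 → ℝ) → ℝ, IsSemialgebraicFunOn ℚ T₂ g → IntegrableOn g T₂ →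
      IsSemialgebraicFunOn ℚ T₁ (fun x => g (Φ x) * |(Φ' x).det|) ∧
        IntegrableOn (fun x => g (Φ x) * |(Φ' x).det|) T₁ := by
    intro g hg hgi
    refine ⟨(IsSemialgebraicFunOn.mul_holds
      (IsSemialgebraicFunOn.comp_isSemialgebraicMapOn_holds hg hΦsa hmaps) hdetsa).congr
      fun x _ => rfl, ?_⟩
    have h := (integrableOn_image_iff_integrableOn_abs_det_fderiv_smul volume hT₁m hΦd hΦinj g).1
      (by rw [himage]; exact hgi)
    exact h.congr_fun (fun x _ => by dsimp only; rw [smul_eq_mul, mul_comm]) hT₁m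
  -- (R1) cut `T` along the fixed curve of `Φ`
  set r₁ := r.restrict T₁ hT₁s hT₁T with hr₁
  set r₂ := r.restrict T₂ hT₂s hT₂T with hr₂
  have R1 : KZ.of r - KZ.of r₁ - KZ.of r₂ ∈ KZ.relations :=
    KZ.domainAddRel_subset_relations ⟨2, r, r₁, r₂, hunion, hnull, fun _ _ => rfl,
      fun _ _ => rfl, rfl⟩
  -- (R2) fold `T₂` onto `T₁`
  obtain ⟨hs_sa, hs_int⟩ := hpull r.integrand (r.isSemialgebraicFunOn_integrand.mono hT₂T hT₂s)
    (r.integrableOn.mono_set hT₂T)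
  let s : KZ.IntegralRep 2 :=
    { domain := T₁
      integrand := fun x => r.integrand (Φ x) * |(Φ' x).det|
      isSemialgebraic_domain := hT₁s
      isSemialgebraicFunOn_integrand := hs_sa
      integrableOn := hs_int }
  have R2 : KZ.of s - KZ.of r₂ ∈ KZ.relations :=
    KZ.changeOfVariablesRel_subset_relations
      ⟨2, s, r₂, Φ, Φ', hΦsa, hΦd, hΦinj, himage.symm, fun _ _ => rfl, rfl⟩
  -- (R3) add the two integrands on `T₁`
  let t : KZ.IntegralRep 2 :=
    { domain := T₁
      integrand := fun x => r.integrand x + r.integrand (Φ x) * |(Φ' x).det|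
      isSemialgebraic_domain := hT₁s
      isSemialgebraicFunOn_integrand :=
        IsSemialgebraicFunOn.add_holds (r.isSemialgebraicFunOn_integrand.mono hT₁T hT₁s) hs_sa
      integrableOn := (r.integrableOn.mono_set hT₁T).add hs_int }
  have R3 : KZ.of t - KZ.of r₁ - KZ.of s ∈ KZ.relations :=
    KZ.integrandAddRel_subset_relations ⟨2, t, r₁, s, rfl, rfl, fun _ _ => rfl, rfl⟩
  -- the antisymmetric integrand `B` on the closed band
  set B : (Fin 2 → ℝ) → ℝ := fun x =>
    -((E.e₁ + (E.e₁ - E.e₂) * (E.e₁ - E.e₃) / (x 1 - E.e₁) - x 1) / √(E.f (x 1))) *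
      (1 / √(E.f (x 0))) with hB
  set band : Set (Fin 2 → ℝ) := {z : Fin 2 → ℝ | Fin.init z ∈ {p : Fin 1 → ℝ | E.e₃ < p 0 ∧
      p 0 < E.e₂} ∧ Fin.init z 0 ≤ z (Fin.last 1) ∧ z (Fin.last 1) ≤ E.e₂} with hband
  have hbands : IsSemialgebraic ℚ band := isSemialgebraic_band E
  have hTband : r.domain ⊆ band := subset_band E fun x hx => (hT x).1 hx
  have hband1 : ∀ z ∈ band, z 1 ≠ E.e₁ := fun z hz =>
    (((mem_band_iff E z).1 hz).2.2.2.trans_lt h21).ne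
  have hBsa : IsSemialgebraicFunOn ℚ band B := isSemialgebraicFunOn_B E hbands hband1
  have hdiff : volume (band \ r.domain) = 0 := volume_band_diff_eq_zero E hT
  have hBint : IntegrableOn B band := by
    have h1 : IntegrableOn B r.domain := integrableOn_B E hTs fun x hx => hTb x hx
    have h2 : IntegrableOn B (band \ r.domain) := by
      rw [IntegrableOn, Measure.restrict_eq_zero.2 hdiff]
      exact integrable_zero_measure
    have h := h2.union h1
    rwa [sdiff_union_of_subset hTband] at h
  let bB : KZ.IntegralRep 2 :=
    { domain := band
      integrand := B
      isSemialgebraic_domain := hbands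
      isSemialgebraicFunOn_integrand := hBsa
      integrableOn := hBint }
  set bT := bB.restrict r.domain hTs hTband with hbT
  set b := bB.restrict T₁ hT₁s (hT₁T.trans hTband) with hb
  set b₂ := bB.restrict T₂ hT₂s (hT₂T.trans hTband) with hb₂
  -- (R5) the symmetric term is the reflection of `B|T₂`
  obtain ⟨ha_sa, ha_int⟩ := hpull B (hBsa.mono (hT₂T.trans hTband) hT₂s)
    (hBint.mono_set (hT₂T.trans hTband))
  let a : KZ.IntegralRep 2 :=
    { domain := T₁
      integrand := fun x => B (Φ x) * |(Φ' x).det|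
      isSemialgebraic_domain := hT₁s
      isSemialgebraicFunOn_integrand := ha_sa
      integrableOn := ha_int }
  have R5 : KZ.of a - KZ.of b₂ ∈ KZ.relations :=
    KZ.changeOfVariablesRel_subset_relations
      ⟨2, a, b₂, Φ, Φ', hΦsa, hΦd, hΦinj, himage.symm, fun _ _ => rfl, rfl⟩
  -- (R4) the pointwise identity `r + Φ^*r = Φ^*B + B` on `T₁`
  have R4 : KZ.of t - KZ.of a - KZ.of b ∈ KZ.relations := by
    refine KZ.integrandAddRel_subset_relations ⟨2, t, a, b, rfl, rfl, fun x hx => ?_, rfl⟩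
    have hxT : x ∈ r.domain := hx.1
    obtain ⟨h0, h0', h1, h1'⟩ := hTb x hxT
    have hΦx : Φ x ∈ r.domain := hT₂T (hmaps hx)
    show r.integrand x + r.integrand (Φ x) * |(Φ' x).det| = B (Φ x) * |(Φ' x).det| + B x
    rw [hint hxT, hint hΦx, hdet]
    simp only [hΦ, hB, Matrix.cons_val_zero, Matrix.cons_val_one]
    rw [sigma_sigma E (h0'.trans h21).ne]
    have hS0 : √(E.f (E.e₁ + (E.e₁ - E.e₂) * (E.e₁ - E.e₃) / (x 0 - E.e₁))) =
        |(-((E.e₁ - E.e₂) * (E.e₁ - E.e₃)) / (x 0 - E.e₁) ^ 2)| * √(E.f (x 0)) := by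
      rw [f_sigma E (h0'.trans h21).ne, Real.sqrt_mul (sq_nonneg _), Real.sqrt_sq_eq_abs]
    have hS1 : √(E.f (E.e₁ + (E.e₁ - E.e₂) * (E.e₁ - E.e₃) / (x 1 - E.e₁))) =
        |(-((E.e₁ - E.e₂) * (E.e₁ - E.e₃)) / (x 1 - E.e₁) ^ 2)| * √(E.f (x 1)) := by
      rw [f_sigma E (h1'.trans h21).ne, Real.sqrt_mul (sq_nonneg _), Real.sqrt_sq_eq_abs]
    rw [hS0, hS1, abs_neg, abs_mul]
    have hy0 : 0 < √(E.f (x 0)) := Real.sqrt_pos.2 (E.f_pos h0 h0')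
    have hy1 : 0 < √(E.f (x 1)) := Real.sqrt_pos.2 (E.f_pos h1 h1')
    have hd0 : 0 < |(-((E.e₁ - E.e₂) * (E.e₁ - E.e₃)) / (x 0 - E.e₁) ^ 2)| :=
      abs_pos.2 (div_ne_zero (neg_ne_zero.2 (A_pos E).ne')
        (pow_ne_zero 2 (sub_ne_zero.2 ((h0'.trans h21).ne))))
    have hd1 : 0 < |(-((E.e₁ - E.e₂) * (E.e₁ - E.e₃)) / (x 1 - E.e₁) ^ 2)| :=
      abs_pos.2 (div_ne_zero (neg_ne_zero.2 (A_pos E).ne')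
        (pow_ne_zero 2 (sub_ne_zero.2 ((h1'.trans h21).ne))))
    generalize |(-((E.e₁ - E.e₂) * (E.e₁ - E.e₃)) / (x 0 - E.e₁) ^ 2)| = D0 at hd0 ⊢
    generalize |(-((E.e₁ - E.e₂) * (E.e₁ - E.e₃)) / (x 1 - E.e₁) ^ 2)| = D1 at hd1 ⊢
    generalize √(E.f (x 0)) = y0 at hy0 ⊢
    generalize √(E.f (x 1)) = y1 at hy1 ⊢
    field_simp
    ring
  -- (R6) glue `B|T₁`, `B|T₂`; (R7) close up to the band; (R8) Newton–Leibniz; (R9) affine move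
  have R6 : KZ.of bT - KZ.of b - KZ.of b₂ ∈ KZ.relations :=
    KZ.domainAddRel_subset_relations ⟨2, bT, b, b₂, hunion, hnull, fun _ _ => rfl,
      fun _ _ => rfl, rfl⟩
  have R7 : KZ.of bB - KZ.of bT ∈ KZ.relations :=
    KZ.of_sub_of_mem_relations_of_null bB bT hdiff
      (by rw [show bT.domain \ bB.domain = ∅ from sdiff_eq_empty.2 hTband, measure_empty])
      fun _ _ => rfl
  obtain ⟨q, hqd, hqi, R8⟩ := nl_move E bB rfl rfl
  have R9 : KZ.of q - KZ.of r' ∈ KZ.relations := cov_affine E q r' hqd hqi hdom' hint'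
  -- bookkeeping in the free abelian group
  show KZ.of r - KZ.of r' ∈ KZ.relations
  have key : KZ.of r - KZ.of r' = (KZ.of r - KZ.of r₁ - KZ.of r₂) - (KZ.of s - KZ.of r₂) -
      (KZ.of t - KZ.of r₁ - KZ.of s) + (KZ.of t - KZ.of a - KZ.of b) + (KZ.of a - KZ.of b₂) -
      (KZ.of bT - KZ.of b - KZ.of b₂) - (KZ.of bB - KZ.of bT) + (KZ.of bB - KZ.of q) +
      (KZ.of q - KZ.of r') := by abel
  rw [key]
  exact add_mem (add_mem (sub_mem (sub_mem (add_mem (add_mem (sub_mem (sub_mem R1 R2) R3) R4)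
    R5) R6) R7) R8) R9

/-- **`KummerFamily`** (item stmt-KontsevichZagierPeriods-6780 of route GenusOneIterated): for every
real cubic with algebraic 2-torsion abscissae `e₃ < e₂ < e₁`,
`∫∫_{e₃<x₀<x₁<e₂} (x₁ − x₀)/(√f(x₀)√f(x₁)) ~ ∫_{e₁−e₂}^{e₁−e₃} du/(2u)`
(`I(ωη) − I(ηω) = ½ log((e₁ − e₃)/(e₁ − e₂))`, a Kummer period) in the Kontsevich–Zagier calculus
of moves, by the nine-move reflection certificate `equivalent`.
[cite: KontsevichZagier2001, §1.2] -/
theorem KummerFamily_proof :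
    Summit.KontsevichZagierPeriods.KontsevichZagierPeriods.Theses.GenusOneIterated.KummerFamily := by
  unfold Summit.KontsevichZagierPeriods.KontsevichZagierPeriods.Theses.GenusOneIterated.KummerFamily
  intro e₁ e₂ e₃ ha₁ ha₂ ha₃ h₃₂ h₂₁ r r' hdom hint hdom' hint'
  exact equivalent ⟨e₁, e₂, e₃, ha₁, ha₂, ha₃, h₃₂, h₂₁⟩ r r' hdom hint hdom' hint'

end Summit.KontsevichZagierPeriods.GenusOneIterated.KummerFamily

end
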